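import Mathlib
import HarnessLib

/-!
# Super-exponential level weights for the filled-matrix shell (crux `PaleySosRung`, line
`weil-patch-transfer`, stub `stub_filledShell`, part 1: arithmetic of the weights)

The shell uses Feige–Krauthgamer pseudomoments `y_S = α_{|S|}·[S clique]` with levels
`α_k = κ_k α^k`, `κ_k = 2^{C(k,2)} · 8^{k²}` (`kap k`).  This file contains only the arithmetic of
`κ`: positivity, monotonicity, the exponent identity
`C(i+j,2) = C(i,2) + C(j,2) + ij`, and the two DOMINANCE facts (all stated for the explicit
expression `2^{C(k,2)}·8^{k²}`, written `κ[k]` through a local notation) that make the leading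
binomial-basis coefficient matrices of the constant part diagonally dominant:

* `kap_dom_sq` : `κ_{a+b+s}² · 2^{a²+b²} · 8^{2|a-b|} ≤ κ_{2a+s} κ_{2b+s} · 2^{2ab}`
  (i.e. `ℓ_s(i,j) ≤ 8^{-|i-j|} √(ℓ_s(i,i) ℓ_s(j,j))` for the leading terms
  `ℓ_s(i,j) = κ_{i+j-s} α^{i+j-s} 2^{-(i-s)(j-s)}`),
* `kap_sq_mul : κ_i² · 2^{i²} · 8^{2i²} = κ_{2i}` (the `s = 0` correction term),

plus the two geometric row-sum bounds `Σ_{j ≠ i} 8^{-|i-j|} ≤ 2/7` and `Σ_{i ≥ 1} 64^{-i²} ≤ 1/63`.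
No graphs appear here.
-/

set_option linter.dupNamespace false -- `Summit.PneNP.PneNP.…`: summit = sub-problem (D-0017)

namespace Summit.PneNP.PneNP.Theorems.PaleySosRungWeilPatch

open Finset

/-- The level weight `κ_k = 2^{C(k,2)} · 8^{k²}` (local notation; no definition is introduced so
that every file of this stub stays a pure theorem file). -/
local notation3 "κ[" k "]" => ((2 : ℝ) ^ (Nat.choose k 2) * (8 : ℝ) ^ (k ^ 2))

/-- `κ_k > 0`. -/
theorem kap_pos (k : ℕ) : 0 < κ[k] := by positivity

/-- `1 ≤ κ_k`. -/
theorem one_le_kap (k : ℕ) : 1 ≤ κ[k] :=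
  one_le_mul_of_one_le_of_one_le (one_le_pow₀ (by norm_num)) (one_le_pow₀ (by norm_num))

/-- `κ_0 = 1`. -/
theorem kap_zero : κ[0] = 1 := by simp

/-- `κ_1 = 8`. -/
theorem kap_one : κ[1] = 8 := by simp

/-- `κ_k ≤ κ_l` for `k ≤ l`. -/
theorem kap_le_kap {k l : ℕ} (h : k ≤ l) : κ[k] ≤ κ[l] :=
  mul_le_mul (pow_le_pow_right₀ (by norm_num) (Nat.choose_mono 2 h))
    (pow_le_pow_right₀ (by norm_num) (Nat.pow_le_pow_left h 2)) (by positivity) (by positivity)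

/-- `C(i+j, 2) = C(i,2) + C(j,2) + i j`. -/
theorem choose_two_add (i j : ℕ) : (i + j).choose 2 = i.choose 2 + j.choose 2 + i * j := by
  induction j with
  | zero => simp
  | succ j ih =>
    rw [show i + (j + 1) = (i + j) + 1 by ring, Nat.choose_succ_succ', ih, Nat.choose_succ_succ',
      Nat.choose_one_right, Nat.choose_one_right]
    ring

/-- The exponent identity behind `kap_dom_sq`:
`2·C(a+b+s,2) + a² + b² = C(2a+s,2) + C(2b+s,2) + 2ab`. -/
theorem two_mul_choose_add (a b s : ℕ) :
    2 * (a + b + s).choose 2 + a ^ 2 + b ^ 2 =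
      (2 * a + s).choose 2 + (2 * b + s).choose 2 + 2 * a * b := by
  have h1 : (a + b + s).choose 2 = (a + b).choose 2 + s.choose 2 + (a + b) * s :=
    choose_two_add _ _
  have h2 : (a + b).choose 2 = a.choose 2 + b.choose 2 + a * b := choose_two_add _ _
  have h3 : (2 * a + s).choose 2 = (2 * a).choose 2 + s.choose 2 + 2 * a * s := choose_two_add _ _
  have h4 : (2 * b + s).choose 2 = (2 * b).choose 2 + s.choose 2 + 2 * b * s := choose_two_add _ _
  have h5 : (2 * a).choose 2 = a.choose 2 + a.choose 2 + a * a := by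
    rw [two_mul]; exact choose_two_add _ _
  have h6 : (2 * b).choose 2 = b.choose 2 + b.choose 2 + b * b := by
    rw [two_mul]; exact choose_two_add _ _
  rw [h1, h2, h3, h4, h5, h6]
  ring

/-- The square-exponent inequality behind `kap_dom_sq`:
`2(a+b+s)² + 2|a-b| ≤ (2a+s)² + (2b+s)²` (with `|a-b| = (a-b)+(b-a)` in `ℕ`). -/
theorem sq_exponent_le (a b s : ℕ) :
    2 * (a + b + s) ^ 2 + 2 * (a - b + (b - a)) ≤ (2 * a + s) ^ 2 + (2 * b + s) ^ 2 := by
  rcases le_total a b with hab | hab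
  · obtain ⟨d, rfl⟩ := Nat.exists_eq_add_of_le hab
    have hd : d ≤ d * d := Nat.le_mul_self d
    have h0 : a - (a + d) = 0 := by omega
    rw [h0, show a + d - a = d by omega, zero_add]
    nlinarith
  · obtain ⟨d, rfl⟩ := Nat.exists_eq_add_of_le hab
    have hd : d ≤ d * d := Nat.le_mul_self d
    have h0 : b - (b + d) = 0 := by omega
    rw [h0, show b + d - b = d by omega, add_zero]
    nlinarith

/-- **Dominance of the leading coefficients**:
`κ_{a+b+s}² · 2^{a²+b²} · 8^{2|a-b|} ≤ κ_{2a+s} · κ_{2b+s} · 2^{2ab}`. -/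
theorem kap_dom_sq (a b s : ℕ) :
    κ[a + b + s] ^ 2 * 2 ^ (a ^ 2 + b ^ 2) * 8 ^ (2 * (a - b + (b - a))) ≤
      κ[2 * a + s] * κ[2 * b + s] * 2 ^ (2 * a * b) := by
  have hL : (2 ^ ((a + b + s).choose 2) * 8 ^ ((a + b + s) ^ 2) : ℝ) ^ 2 * 2 ^ (a ^ 2 + b ^ 2) *
      8 ^ (2 * (a - b + (b - a))) =
      2 ^ (2 * (a + b + s).choose 2 + a ^ 2 + b ^ 2) *
        8 ^ (2 * (a + b + s) ^ 2 + 2 * (a - b + (b - a))) := by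
    ring
  have hR : (2 ^ ((2 * a + s).choose 2) * 8 ^ ((2 * a + s) ^ 2) : ℝ) *
      (2 ^ ((2 * b + s).choose 2) * 8 ^ ((2 * b + s) ^ 2)) * 2 ^ (2 * a * b) =
      2 ^ ((2 * a + s).choose 2 + (2 * b + s).choose 2 + 2 * a * b) *
        8 ^ ((2 * a + s) ^ 2 + (2 * b + s) ^ 2) := by
    ring
  rw [hL, hR, two_mul_choose_add]
  exact mul_le_mul_of_nonneg_left (pow_le_pow_right₀ (by norm_num) (sq_exponent_le a b s))
    (by positivity)

/-- The `s = 0` correction identity: `κ_i² · 2^{i²} · 8^{2i²} = κ_{2i}`. -/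
theorem kap_sq_mul (i : ℕ) : κ[i] ^ 2 * 2 ^ (i ^ 2) * 8 ^ (2 * i ^ 2) = κ[2 * i] := by
  have h : (2 * i).choose 2 = i.choose 2 + i.choose 2 + i * i := by
    rw [two_mul]; exact choose_two_add _ _
  rw [h]
  ring

/-! ### Geometric row sums -/

/-- A sum of DISTINCT positive powers of `1/8` is at most `1/7`. -/
theorem sum_inv_eight_pow_le {S : Finset ℕ} (hS : ∀ d ∈ S, 1 ≤ d) :
    ∑ d ∈ S, (8 : ℝ)⁻¹ ^ d ≤ 1 / 7 := by
  -- compare with the full geometric tail `Σ_{1 ≤ d < N} 8^{-d}`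
  obtain ⟨N, hN⟩ : ∃ N, ∀ d ∈ S, d < N :=
    ⟨S.sup id + 1, fun d hd => Nat.lt_succ_of_le (le_sup (f := id) hd)⟩
  have hsub : S ⊆ Finset.Ico 1 N := fun d hd => Finset.mem_Ico.2 ⟨hS d hd, hN d hd⟩
  calc ∑ d ∈ S, (8 : ℝ)⁻¹ ^ d ≤ ∑ d ∈ Finset.Ico 1 N, (8 : ℝ)⁻¹ ^ d :=
        Finset.sum_le_sum_of_subset_of_nonneg hsub fun _ _ _ => by positivity
    _ ≤ 1 / 7 := by
        rcases Nat.lt_or_ge N 1 with hN1 | hN1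
        · rw [Finset.Ico_eq_empty (by omega)]; norm_num
        · rw [geom_sum_Ico (by norm_num) hN1, pow_one,
            div_le_iff_of_neg (by norm_num : (8 : ℝ)⁻¹ - 1 < 0)]
          have h8 : (0 : ℝ) ≤ (8 : ℝ)⁻¹ ^ N := by positivity
          linarith

/-- **Row sums of the dominance kernel**: for every `i` and every finite set `J` of indices,
`Σ_{j ∈ J, j ≠ i} 8^{-|i-j|} ≤ 2/7`. -/
theorem sum_inv_eight_pow_dist_le (i : ℕ) (J : Finset ℕ) :
    ∑ j ∈ J.filter (· ≠ i), (8 : ℝ)⁻¹ ^ (i - j + (j - i)) ≤ 2 / 7 := by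
  -- split `J ∖ {i}` into `j < i` and `i < j`; on each part `j ↦ |i - j|` is injective
  have hsplit : J.filter (· ≠ i) = J.filter (· < i) ∪ J.filter (i < ·) := by
    ext j; simp only [Finset.mem_filter, Finset.mem_union]; constructor
    · rintro ⟨hj, hne⟩
      rcases lt_or_gt_of_ne hne with h | h
      · exact Or.inl ⟨hj, h⟩
      · exact Or.inr ⟨hj, h⟩
    · rintro (⟨hj, h⟩ | ⟨hj, h⟩)
      · exact ⟨hj, h.ne⟩
      · exact ⟨hj, h.ne'⟩
  have hdisj : Disjoint (J.filter (· < i)) (J.filter (i < ·)) := by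
    rw [Finset.disjoint_filter]; intro j _ h1 h2; omega
  rw [hsplit, Finset.sum_union hdisj]
  have hA : ∑ j ∈ J.filter (· < i), (8 : ℝ)⁻¹ ^ (i - j + (j - i)) ≤ 1 / 7 := by
    rw [← Finset.sum_image (f := fun d => (8 : ℝ)⁻¹ ^ d) (s := J.filter (· < i))
      (g := fun j => i - j + (j - i)) ?_]
    · refine sum_inv_eight_pow_le fun d hd => ?_
      obtain ⟨j, hj, rfl⟩ := Finset.mem_image.1 hd
      have := (Finset.mem_filter.1 hj).2; omega
    · intro j hj j' hj' h
      have h1 := (Finset.mem_filter.1 hj).2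
      have h2 := (Finset.mem_filter.1 hj').2
      simp only at h; omega
  have hB : ∑ j ∈ J.filter (i < ·), (8 : ℝ)⁻¹ ^ (i - j + (j - i)) ≤ 1 / 7 := by
    rw [← Finset.sum_image (f := fun d => (8 : ℝ)⁻¹ ^ d) (s := J.filter (i < ·))
      (g := fun j => i - j + (j - i)) ?_]
    · refine sum_inv_eight_pow_le fun d hd => ?_
      obtain ⟨j, hj, rfl⟩ := Finset.mem_image.1 hd
      have := (Finset.mem_filter.1 hj).2; omega
    · intro j hj j' hj' h
      have h1 := (Finset.mem_filter.1 hj).2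
      have h2 := (Finset.mem_filter.1 hj').2
      simp only at h; omega
  linarith

/-- A sum of distinct powers `64^{-d}`, `d ≥ 1`, is at most `1/63`. -/
theorem sum_inv_sixtyfour_pow_le {S : Finset ℕ} (hS : ∀ d ∈ S, 1 ≤ d) :
    ∑ d ∈ S, (64 : ℝ)⁻¹ ^ d ≤ 1 / 63 := by
  obtain ⟨N, hN⟩ : ∃ N, ∀ d ∈ S, d < N :=
    ⟨S.sup id + 1, fun d hd => Nat.lt_succ_of_le (le_sup (f := id) hd)⟩
  have hsub : S ⊆ Finset.Ico 1 N := fun d hd => Finset.mem_Ico.2 ⟨hS d hd, hN d hd⟩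
  calc ∑ d ∈ S, (64 : ℝ)⁻¹ ^ d ≤ ∑ d ∈ Finset.Ico 1 N, (64 : ℝ)⁻¹ ^ d :=
        Finset.sum_le_sum_of_subset_of_nonneg hsub fun _ _ _ => by positivity
    _ ≤ 1 / 63 := by
        rcases Nat.lt_or_ge N 1 with hN1 | hN1
        · rw [Finset.Ico_eq_empty (by omega)]; norm_num
        · rw [geom_sum_Ico (by norm_num) hN1, pow_one,
            div_le_iff_of_neg (by norm_num : (64 : ℝ)⁻¹ - 1 < 0)]
          have h8 : (0 : ℝ) ≤ (64 : ℝ)⁻¹ ^ N := by positivity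
          linarith

/-- `Σ_{i ∈ J} 64^{-i²} ≤ 1/63` for a set `J` of positive integers (the map `i ↦ i²` is
injective). -/
theorem sum_inv_sixtyfour_pow_sq_le (J : Finset ℕ) (hJ : ∀ i ∈ J, 1 ≤ i) :
    ∑ i ∈ J, (64 : ℝ)⁻¹ ^ (i ^ 2) ≤ 1 / 63 := by
  rw [← Finset.sum_image (f := fun d => (64 : ℝ)⁻¹ ^ d) (s := J) (g := fun i => i ^ 2) ?_]
  · refine sum_inv_sixtyfour_pow_le fun d hd => ?_
    obtain ⟨i, hi, rfl⟩ := Finset.mem_image.1 hd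
    have := hJ i hi
    nlinarith
  · intro i _ i' _ h
    exact (Nat.pow_left_injective two_ne_zero) h

end Summit.PneNP.PneNP.Theorems.PaleySosRungWeilPatch

namespace Summit.PneNP.PneNP.Theorems.PaleySosRungWeilPatch

/-- Registered sub-goal `aux_shellLevels` of stub `stub_filledShell` (crux stmt-PneNP-9817): the
dominance inequality `kap_dom_sq` with the level weights written out. -/
theorem aux_shellLevels : ∀ a b s : ℕ,
    ((2 : ℝ) ^ ((a + b + s).choose 2) * (8 : ℝ) ^ ((a + b + s) ^ 2)) ^ 2 * 2 ^ (a ^ 2 + b ^ 2) *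
        8 ^ (2 * (a - b + (b - a))) ≤
      ((2 : ℝ) ^ ((2 * a + s).choose 2) * (8 : ℝ) ^ ((2 * a + s) ^ 2)) *
        ((2 : ℝ) ^ ((2 * b + s).choose 2) * (8 : ℝ) ^ ((2 * b + s) ^ 2)) * 2 ^ (2 * a * b) :=
  fun a b s => kap_dom_sq a b s

end Summit.PneNP.PneNP.Theorems.PaleySosRungWeilPatch
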